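import Literature.NumberTheory.LFunctions.HeckeGaussianFourier
import HarnessLib

/-!
# Hecke's theta functions with sign weights and a shift, and their transformation formula

Topic `Literature/NumberTheory/LFunctions`; namespace `Literature.NumberTheory.LFunctions.NumberField`
(continuing `DedekindZetaTheta.lean` / `DedekindZetaThetaProofs.lean`, whose case `p = 0`, `a₀ = 0`
this generalises).  Analytic input of the continuation of the partial zeta functions of narrow ray
classes (`RayClassPartialZeta.lean`, named fact `rayClassPartialZeta_hasMeromorphicContinuation`).

For a number field `K`, a nonzero fractional ideal `𝔞`, a shift `a₀ ∈ K`, a set `p` of real places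
(the "admissible exponent" `p ∈ ∏_{τ real} {0,1}` of Neukirch VII §3 (before (3.3)), encoded by the set of `τ`
with `p_τ = 1`) and `y ∈ R_+^*` we define (as complex numbers)

* `heckeTheta K p 𝔞 a₀ y = Σ_{a ∈ 𝔞} N((a+a₀)^p) e^{-π⟨(a+a₀)y, a+a₀⟩}`, the theta series of the
  coset `a₀ + 𝔞` with the weight `N(x^p) = ∏_{τ ∈ p} τ(x)` (Neukirch VII (3.4): `θ_Γ^p(a, b, z)`
  with `b = 0`, `z = iy`, up to the notation for the shift);
* `heckeThetaDual K p 𝔟 a₀ y = Σ_{b ∈ 𝔟} e^{2πi Tr(a₀ b)} N(b^p) e^{-π⟨by, b⟩}`, the dual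
  (character-twisted, unshifted) series (Neukirch's `θ_{Γ'}^p(-b, a, ·)` side of (3.6)),

and PROVE the **theta transformation formula** (Neukirch VII (3.6) for the lattice `Γ = 𝔞` with its
dual `Γ' = (𝔞𝔡)⁻¹` for the trace form, (5.7), at `z = iy`):

  `heckeTheta K p 𝔞 a₀ y = (-i)^{|p|} (∏_{τ∈p} y_τ)⁻¹ (N(y)^{1/2} 𝔑(𝔞) √|d_K|)⁻¹ ·
      heckeThetaDual K p (𝔞𝔡)⁻¹ a₀ y⁻¹`                 (`heckeTheta_eq_heckeThetaDual`).

## Proof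

Exactly as `thetaIdeal_eq_inv_mul_thetaIdeal_dual` (`DedekindZetaThetaProofs.lean`): Poisson
summation (`Fourier.tsum_eq_tsum_fourier_of_rpow_decay`) in the euclidean Minkowski space `V` for the
scaled ideal lattice `Λ_y = toMixed⁻¹(c · j(𝔞))`, `c_w = (e_w y_w)^{1/2}`, whose dual lattice is
`toMixed⁻¹(c⁻¹ · *j((𝔞𝔡)⁻¹))` (`dualIdealEquivDualLattice`), now applied to the translate
`v ↦ (P G)(v + x₀)`, `x₀ = toMixed⁻¹(c · j(a₀))`, of the harmonic-polynomial multiple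
`P(v) G(v) = ∏_{τ ∈ p} ⟨v, E_τ⟩ e^{-π‖v‖²}` of the Gaussian (`E_τ` the coordinate vector of the real
place `τ`), whose Fourier transform is `e^{2πi⟨x₀,ξ⟩} (-i)^{|p|} P(ξ) G(ξ)`
(`Fourier.fourier_polyGaussian_add`, `HeckeGaussianFourier.lean`).  On lattice vectors
`P(toMixed⁻¹(c·j(a))) = ∏_{τ∈p} y_τ^{1/2} τ(a)`, on dual vectors
`P(toMixed⁻¹(c⁻¹·*j(a'))) = ∏_{τ∈p} y_τ^{-1/2} τ(a')`, and `⟨x₀, toMixed⁻¹(c⁻¹·*j(a'))⟩ = Tr(a₀ a')`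
(`inner_dualVector_latticeVector`).

## References

* J. Neukirch, *Algebraic Number Theory*, Grundlehren 322, Springer 1999, Ch. VII §3 (3.3) Proposition,
  (3.4) Definition, (3.6) Theta Transformation Formula; §5 (5.7). [NeukirchANT1999]
* E. Hecke, *Eine neue Art von Zetafunktionen und ihre Beziehungen zur Verteilung der Primzahlen
  II*, Math. Z. 6 (1920), 11–51. [HeckeMathZ1920]
-/

noncomputable section

open MeasureTheory Filter Set Submodule Complex NumberField NumberField.InfinitePlace
  NumberField.mixedEmbedding
open scoped Real Topology FourierTransform ENNReal NumberField nonZeroDivisors ComplexConjugate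
  RealInnerProductSpace

namespace Literature.NumberTheory.LFunctions

namespace NumberField

variable (K : Type*) [Field K] [NumberField K]

open scoped Classical

/-! ## The coordinate vectors of the real places and the weight `N(x^p)` -/

/-- The unit coordinate vector `E_τ ∈ V` of the real place `τ` in the euclidean Minkowski space
(`stdOrthonormalBasis (inl τ)`). [folklore] -/
def realPlaceVector (w : {w : InfinitePlace K // IsReal w}) : euclidean.mixedSpace K :=
  euclidean.stdOrthonormalBasis K (Sum.inl w)

/-- The **weight `N(x^p) = ∏_{τ ∈ p} τ(x)`** of an element of `K` for a set `p` of real places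
(Neukirch VII §3, before (3.3): `N(x^p)` for the admissible `p` with `p_τ = 1` exactly on `p`).
[folklore] -/
def realPow (p : Finset {w : InfinitePlace K // IsReal w}) (a : K) : ℝ :=
  ∏ w ∈ p, (mixedEmbedding K a).1 w

variable {K}

/-- `⟪toMixed⁻¹ u, E_τ⟫ = u_τ`: pairing with `E_τ` extracts the real coordinate at `τ`. [folklore] -/
theorem inner_toMixed_symm_realPlaceVector (u : mixedSpace K) (w : {w : InfinitePlace K // IsReal w}) :
    ⟪(euclidean.toMixed K).symm u, realPlaceVector K w⟫ = u.1 w := by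
  rw [realPlaceVector, real_inner_comm, ← OrthonormalBasis.repr_apply_apply,
    stdOrthonormalBasis_repr_apply, ContinuousLinearEquiv.apply_symm_apply, stdBasis_apply_isReal]

/-- The coordinate vectors of distinct real places are orthogonal. [folklore] -/
theorem inner_realPlaceVector_of_ne {w w' : {w : InfinitePlace K // IsReal w}} (h : w ≠ w') :
    ⟪realPlaceVector K w, realPlaceVector K w'⟫ = 0 :=
  (euclidean.stdOrthonormalBasis K).orthonormal.inner_eq_zero (fun h' ↦ h (Sum.inl_injective h'))

/-- `N(x^p)` on a scaled lattice vector: `∏_{τ∈p} ⟪toMixed⁻¹(c·j(a)), E_τ⟫ = (∏_{τ∈p} c_τ) N(a^p)`.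
[folklore] -/
theorem prod_inner_scaleMixed_mixedEmbedding (p : Finset {w : InfinitePlace K // IsReal w})
    (c : InfinitePlace K → ℝ) (a : K) :
    ∏ w ∈ p, ⟪(euclidean.toMixed K).symm (scaleMixed K c (mixedEmbedding K a)), realPlaceVector K w⟫ =
      (∏ w ∈ p, c w.1) * realPow K p a := by
  rw [realPow, ← Finset.prod_mul_distrib]
  exact Finset.prod_congr rfl fun w _ ↦ by rw [inner_toMixed_symm_realPlaceVector, scaleMixed_apply_fst]

/-- `N(x^p)` on a scaled dual vector: `∏_{τ∈p} ⟪toMixed⁻¹(c⁻¹·*j(a')), E_τ⟫ = (∏_{τ∈p} c_τ⁻¹) N(a'^p)`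
(`*` is the identity at real places). [folklore] -/
theorem prod_inner_scaleMixed_inv_twistMixed (p : Finset {w : InfinitePlace K // IsReal w})
    (c : InfinitePlace K → ℝ) (a' : K) :
    ∏ w ∈ p, ⟪(euclidean.toMixed K).symm (scaleMixed K c⁻¹ (twistMixed (mixedEmbedding K a'))),
        realPlaceVector K w⟫ = (∏ w ∈ p, (c w.1)⁻¹) * realPow K p a' := by
  rw [realPow, ← Finset.prod_mul_distrib]
  exact Finset.prod_congr rfl fun w _ ↦ by
    rw [inner_toMixed_symm_realPlaceVector, scaleMixed_apply_fst, twistMixed_fst, Pi.inv_apply]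

/-! ## Hecke's theta functions -/

variable (K)

/-- **Hecke's theta series of the coset `a₀ + 𝔞` with weight `N(x^p)`** at `z = iy`, `y ∈ R_+^*`:
`Θ^p_{𝔞,a₀}(y) = Σ_{a ∈ 𝔞} N((a+a₀)^p) e^{-π⟨(a+a₀)y, a+a₀⟩}` (Neukirch VII (3.4) Definition,
`θ_Γ^p(a, b, z) = Σ_{g ∈ Γ} N((a+g)^p) e^{πi⟨(a+g)z, a+g⟩ + 2πi⟨b,g⟩}` for `Γ = j(𝔞)`, `a = a₀`,
`b = 0`, `z = iy`), as a complex number.  For `p = ∅`, `a₀ = 0` this is `θ_𝔞(iy) = thetaIdeal K 𝔞 y`.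
[cite: NeukirchANT1999, Ch. VII §3 (3.4) Definition] -/
def heckeTheta (p : Finset {w : InfinitePlace K // IsReal w}) (I : FractionalIdeal (𝓞 K)⁰ K) (a₀ : K)
    (y : InfinitePlace K → ℝ) : ℂ :=
  ∑' a : I, ((realPow K p ((a : K) + a₀) * thetaSummand K y ((a : K) + a₀) : ℝ) : ℂ)

/-- **The dual theta series** `Θ̂^p_{𝔟,a₀}(y) = Σ_{b ∈ 𝔟} e^{2πi Tr(a₀ b)} N(b^p) e^{-π⟨by, b⟩}`
(Neukirch's `θ_{Γ'}^p(-b, a, ·)` side of (3.6) with `b = 0`: character `e^{2πi⟨a₀, b⟩}`,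
`⟨a₀, b⟩ = Tr(a₀ b)` for the trace form, no shift). [cite: NeukirchANT1999, Ch. VII §3 (3.4) Definition and (3.6)] -/
def heckeThetaDual (p : Finset {w : InfinitePlace K // IsReal w}) (I : FractionalIdeal (𝓞 K)⁰ K)
    (a₀ : K) (y : InfinitePlace K → ℝ) : ℂ :=
  ∑' b : I, (𝐞 (((Algebra.trace ℚ K (a₀ * (b : K)) : ℚ) : ℝ)) : ℂ) *
    ((realPow K p (b : K) * thetaSummand K y (b : K) : ℝ) : ℂ)

variable {K}

/-! ## The transformation formula -/

omit [NumberField K] in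
/-- The scaling vector `c_w = (e_w t_w)^{1/2}` is nonvanishing for `t > 0`. [folklore] -/
theorem sqrt_mult_mul_ne_zero {t : InfinitePlace K → ℝ} (ht : ∀ w, 0 < t w) (w : InfinitePlace K) :
    Real.sqrt (mult w * t w) ≠ 0 :=
  (Real.sqrt_pos.mpr (mul_pos (Nat.cast_pos.mpr mult_pos) (ht w))).ne'

omit [NumberField K] in
/-- At a real place the scaling factor is `t_τ^{1/2}` (`e_τ = 1`). [folklore] -/
theorem sqrt_mult_mul_of_isReal (t : InfinitePlace K → ℝ) (w : {w : InfinitePlace K // IsReal w}) :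
    Real.sqrt (mult w.1 * t w.1) = Real.sqrt (t w.1) := by
  rw [mult_isReal w, Nat.cast_one, one_mul]

/-- **Theta transformation formula with sign weights and a shift** (Neukirch VII (3.6) Theta
Transformation Formula, `θ_Γ^p(a,b,-1/z) = [i^{Tr(p)} e^{2πi⟨a,b⟩} vol(Γ)]⁻¹ N((z/i)^{p+1/2}) θ_{Γ'}^p(-b,a,z)`,
for `Γ = j(𝔞)`, `Γ' = *j((𝔞𝔡)⁻¹)` (VII (5.7)), `z = it⁻¹`, `b = 0`; Hecke 1920): for a nonzero
fractional ideal `𝔞`, `a₀ ∈ K`, a set `p` of real places and `t ∈ R_+^*`,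
`Θ^p_{𝔞,a₀}(t) = (-i)^{|p|} (∏_{τ∈p} t_τ)⁻¹ (N(t)^{1/2} 𝔑(𝔞) √|d_K|)⁻¹ Θ̂^p_{(𝔞𝔡)⁻¹,a₀}(t⁻¹)`.
[cite: NeukirchANT1999, Ch. VII §3 (3.6) Theta Transformation Formula, with (5.7)] -/
theorem heckeTheta_eq_heckeThetaDual (p : Finset {w : InfinitePlace K // IsReal w})
    (I : (FractionalIdeal (𝓞 K)⁰ K)ˣ) (a₀ : K) {t : InfinitePlace K → ℝ} (ht : ∀ w, 0 < t w) :
    heckeTheta K p I a₀ t =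
      (-Complex.I) ^ p.card * (((∏ w ∈ p, t w.1) * (Real.sqrt (mixedNorm K t) *
        ((FractionalIdeal.absNorm (I : FractionalIdeal (𝓞 K)⁰ K) : ℝ) * Real.sqrt |(discr K : ℝ)|)) : ℝ) : ℂ)⁻¹ *
      heckeThetaDual K p (FractionalIdeal.dual ℤ ℚ (I : FractionalIdeal (𝓞 K)⁰ K)) a₀ (fun w ↦ (t w)⁻¹) := by
  set c : InfinitePlace K → ℝ := fun w ↦ Real.sqrt (mult w * t w) with hcdef
  have hc : ∀ w, c w ≠ 0 := sqrt_mult_mul_ne_zero ht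
  set Λ := scaledIdealLattice c hc I with hΛ
  set x₀ : euclidean.mixedSpace K := (euclidean.toMixed K).symm (scaleMixed K c (mixedEmbedding K a₀))
    with hx₀
  have horth : ∀ i ∈ p, ∀ j ∈ p, i ≠ j → ⟪realPlaceVector K i, realPlaceVector K j⟫ = 0 :=
    fun i _ j _ hij ↦ inner_realPlaceVector_of_ne hij
  set F : euclidean.mixedSpace K → ℂ := fun v ↦ Fourier.polyGaussian p (realPlaceVector K) (v + x₀)
    with hF
  -- hypotheses of Poisson summation
  set b : ℝ := Module.finrank ℝ (euclidean.mixedSpace K) + 1 with hbdef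
  have hb : (Module.finrank ℝ (euclidean.mixedSpace K) : ℝ) < b := by rw [hbdef]; linarith
  have hb0 : 0 ≤ b := by rw [hbdef]; positivity
  obtain ⟨C, hC⟩ := Fourier.norm_polyGaussian_add_le p (realPlaceVector K) x₀ hb0
  have hFour := Fourier.fourier_polyGaussian_add p (realPlaceVector K) horth x₀
  obtain ⟨C', hC'⟩ := Fourier.norm_polyGaussian_add_le p (realPlaceVector K) (0 : euclidean.mixedSpace K) hb0
  have hdec' : ∀ v : euclidean.mixedSpace K, ‖𝓕 F v‖ ≤ C' * (1 + ‖v‖) ^ (-b) := by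
    intro v
    rw [hF, hFour]
    dsimp only
    rw [norm_mul, Circle.norm_coe, one_mul, norm_mul, norm_pow, norm_neg, Complex.norm_I, one_pow,
      one_mul]
    simpa using hC' v
  have hsum : Summable fun g' : Literature.Algebra.EuclideanLattices.dualLattice Λ ↦ 𝓕 F g' :=
    Fourier.summable_of_decay_zlattice _ hb hdec'
  have key := Fourier.tsum_eq_tsum_fourier_of_rpow_decay Λ
    (Fourier.continuous_polyGaussian_add p (realPlaceVector K) x₀) hb hC hsum
  -- the lattice side
  have hL : ∑' g : Λ, F g = (((∏ w ∈ p, Real.sqrt (t w.1)) : ℝ) : ℂ) * heckeTheta K p I a₀ t := by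
    rw [← (idealEquivScaledIdealLattice c hc I).tsum_eq, heckeTheta, ← tsum_mul_left]
    refine tsum_congr fun a ↦ ?_
    rw [coe_idealEquivScaledIdealLattice_apply, hF]
    dsimp only
    rw [hx₀, ← map_add, ← map_add, ← map_add, Fourier.polyGaussian_apply,
      ← Complex.ofReal_prod, prod_inner_scaleMixed_mixedEmbedding, hcdef,
      norm_sq_scaleMixed_mixedEmbedding (fun w ↦ (ht w).le), thetaSummand]
    simp only [sqrt_mult_mul_of_isReal]
    push_cast
    ring
  -- the dual side
  have hR : ∑' g' : Literature.Algebra.EuclideanLattices.dualLattice Λ, 𝓕 F g' =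
      (-Complex.I) ^ p.card * (((∏ w ∈ p, (Real.sqrt (t w.1))⁻¹) : ℝ) : ℂ) *
        heckeThetaDual K p (FractionalIdeal.dual ℤ ℚ (I : FractionalIdeal (𝓞 K)⁰ K)) a₀ (fun w ↦ (t w)⁻¹) := by
    rw [← (dualIdealEquivDualLattice c hc I).tsum_eq, heckeThetaDual, ← tsum_mul_left]
    refine tsum_congr fun a' ↦ ?_
    rw [coe_dualIdealEquivDualLattice_apply, hFour]
    dsimp only
    rw [hx₀, real_inner_comm, inner_dualVector_latticeVector hc, Fourier.polyGaussian_apply,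
      ← Complex.ofReal_prod, prod_inner_scaleMixed_inv_twistMixed, hcdef,
      norm_sq_scaleMixed_inv_twistMixed ht, thetaSummand, mul_comm (a' : K) a₀]
    simp only [sqrt_mult_mul_of_isReal]
    push_cast
    ring
  rw [hL, hR, covolume_scaledIdealLattice_sqrt ht hc I, Complex.real_smul] at key
  -- solve for `heckeTheta`
  have hsqrt : ∀ w : {w : InfinitePlace K // IsReal w}, 0 < Real.sqrt (t w.1) := fun w ↦
    Real.sqrt_pos.mpr (ht w.1)
  have hP : (((∏ w ∈ p, Real.sqrt (t w.1)) : ℝ) : ℂ) ≠ 0 := by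
    exact_mod_cast (Finset.prod_pos fun w _ ↦ hsqrt w).ne'
  have hprod : (∏ w ∈ p, (Real.sqrt (t w.1))⁻¹) * (∏ w ∈ p, Real.sqrt (t w.1))⁻¹ =
      (∏ w ∈ p, t w.1)⁻¹ := by
    rw [Finset.prod_inv_distrib, ← mul_inv, ← Finset.prod_mul_distrib]
    congr 1
    exact Finset.prod_congr rfl fun w _ ↦ Real.mul_self_sqrt (ht w.1).le
  have hΘ : heckeTheta K p I a₀ t =
      (((∏ w ∈ p, Real.sqrt (t w.1) : ℝ) : ℂ))⁻¹ *
        ((((Real.sqrt (mixedNorm K t) *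
            ((FractionalIdeal.absNorm (I : FractionalIdeal (𝓞 K)⁰ K) : ℝ) * Real.sqrt |(discr K : ℝ)|))⁻¹ : ℝ) :
              ℂ) *
          ((-Complex.I) ^ p.card * ((∏ w ∈ p, (Real.sqrt (t w.1))⁻¹ : ℝ) : ℂ) *
            heckeThetaDual K p (FractionalIdeal.dual ℤ ℚ (I : FractionalIdeal (𝓞 K)⁰ K)) a₀
              (fun w ↦ (t w)⁻¹))) := by
    rw [← key, ← mul_assoc, inv_mul_cancel₀ hP, one_mul]
  rw [hΘ]
  have hprod' := congrArg (fun r : ℝ ↦ (r : ℂ)) hprod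
  push_cast at hprod' ⊢
  linear_combination (-Complex.I) ^ p.card *
    (((Real.sqrt (mixedNorm K t) : ℝ) : ℂ) * (((FractionalIdeal.absNorm (I : FractionalIdeal (𝓞 K)⁰ K) : ℝ) : ℂ) *
      ((Real.sqrt |(discr K : ℝ)| : ℝ) : ℂ)))⁻¹ *
    heckeThetaDual K p (FractionalIdeal.dual ℤ ℚ (I : FractionalIdeal (𝓞 K)⁰ K)) a₀ (fun w ↦ (t w)⁻¹) * hprod'

end NumberField

end Literature.NumberTheory.LFunctions
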